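import Summits.BirchSwinnertonDyer.BirchSwinnertonDyer.Theorems.BiquadraticEisensteinDescentHeegnerTwistCouplingInSupplySymbolicMonskyEvenKernelParity
import HarnessLib

set_option linter.dupNamespace false -- `Summit.BirchSwinnertonDyer.BirchSwinnertonDyer.Theorems.…` (summit = sub)
set_option autoImplicit false

/-!
# Crux `HeegnerTwistCouplingInSupply` (stmt-BirchSwinnertonDyer-21381) — the even one-stage door on the family `P_b ≡ 3, 5 (mod 8)`:
# OPEN IFF the vertical kernel pairs fit, and then `δ = 0` works (a complete answer on the family of the first exceptional bases)

Route `BiquadraticEisensteinDescent` (cell `pub/bsd-wall`, width seat `bsd-wall-cm-bed-w3` g24; `--supports` 21381, helper). Third of the family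
theorems (`…EvenDesignNegTwoTrivial` p752709: `P_b ≡ ±1 (mod 8)`; `…EvenDesignClassesOneThree` p753061: `P_b ≡ 1, 3 (mod 8)`). Here every base prime has
`(2/P_b) = −1` (`P_b ≡ 3, 5 (mod 8)`, `d = 1`), μ is odd and some `P_b ≡ 5 (mod 8)` (all-`3 (mod 8)` bases belong to p753061). This is the family of
the first even exceptional bases (`(3,5,5,5,5)`, `even_universality_fails`, p750799), so no hypothesis-free theorem is possible; instead:
* ★★ `evenPencil_zero_hypotheses_of_negTwo_true` — if `dim{(0,v) ∈ 𝒦_ev} ≤ τ₀^{ev} = (dim 𝒦_ev + 1)/2` then `δ = 0`, `τ = τ₀^{ev}` satisfy ALL FIVE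
  hypotheses of EVEN THEOREM A: the pencil of `δ = 0` is `{(v + ⟨m,u⟩·1, u + γ·1)}`; its `V×0` section is `{(v,0) : (0,v) ∈ 𝒦_ev}` (a prime
  `≡ 5 (mod 8)` forces `γ = 0`), its `0×V` section is the line `⟨(0,1)⟩`, its diagonal section is `0`, and `(0,1) ∉ T_0(𝒦_ev)` (`(1,1) ∉ 𝒦_ev`);
* ★★★ `exists_patternFree_even_design_of_negTwo_true` — hence a pattern-free Heegner recipe with `τ₀^{ev} + 1` auxiliary primes;
* ★★★ `even_door_iff_of_negTwo_true` — on this family SOME `(δ, τ)` satisfies the hypotheses of EVEN THEOREM A IFF `dim{(0,v) ∈ 𝒦_ev} ≤ τ₀^{ev}`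
  (`→`: obstruction `finrank_le_evenPencil_inf_ker_snd` + kernel parity; `←`: `δ = 0`).
Numerics (memo EVEN-EXCEPTIONAL-CLASS-w3g24 §2c): exhaustive `K ≤ 5` (16 933 bases of the family, 10 exceptional) and 159 977 sampled `K ≤ 12`
(4 471 exceptional): `δ = 0` good ⟺ `a₁ ≤ τ₀^{ev}` in every case.

HONEST FRAMING: RUNG-LEVEL corner layer (even congruent `j = 1728` families `E_{2n₀}`); statements about Monsky matrices; instances of the crux still need
located primes and the print input; the crux as stated (C⁺), its registered stubs and BSD are NOT touched; nothing is closed. THEOREMS ONLY.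
Reference: [HeathBrown1994] D. R. Heath-Brown, Invent. Math. 118 (1994) 331–370, appendix (Monsky), typescript p. 41 L20–L36.
-/

namespace Summit.BirchSwinnertonDyer.BirchSwinnertonDyer.Theorems.SymbolicMonsky

section ClassesThreeFive

open Module Matrix

variable {k : ℕ} (base : SymbData (k + 1))

/-- ★★ **Hypotheses of EVEN THEOREM A for `δ = 0` on the family `P_b ≡ 3, 5 (mod 8)`** (all `(2/P_b) = −1`, μ odd, some `P_b ≡ 5 (mod 8)`):
if the vertical pairs `(0,v) ∈ 𝒦_ev` span `≤ τ₀^{ev}` dimensions then `(0,1) ∉ T_0(𝒦_ev)`, `dim W_ev(0) = 2τ₀^{ev}`, and the three plane sections of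
`W_ev(0)` have dimension `≤ τ₀^{ev}` (they are `{(v,0) : (0,v) ∈ 𝒦_ev}`, the line `⟨(0,1)⟩`, and `0`).
[cite: HeathBrown1994SelmerCongruentII, Appendix (Monsky), typescript p. 41 L20–L36] -/
theorem evenPencil_zero_hypotheses_of_negTwo_true (hd : ∀ b, negTwo (base.cls b) = true)
    (hμ : (∑ b, bz (negNegOne (base.cls b))) = 1) (h5 : ∃ b, negNegOne (base.cls b) = false)
    (ha1 : finrank (ZMod 2) ↥(base.evenVirtualKernel ⊓
      LinearMap.ker (LinearMap.fst (ZMod 2) (Fin (k + 1) → ZMod 2) (Fin (k + 1) → ZMod 2))) ≤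
        (finrank (ZMod 2) ↥base.evenVirtualKernel + 1) / 2) :
    (((fun _ => (0 : ZMod 2)), fun i => 1 + (fun _ => (0 : ZMod 2)) i) : (Fin (k + 1) → ZMod 2) × (Fin (k + 1) → ZMod 2)) ∉
        base.evenVirtualKernel.map (base.evenTwist (fun _ => 0)) ∧
      finrank (ZMod 2) ↥(base.evenPencil (fun _ => 0)) = 2 * ((finrank (ZMod 2) ↥base.evenVirtualKernel + 1) / 2) ∧
      finrank (ZMod 2) ↥(base.evenPencil (fun _ => 0) ⊓
        LinearMap.ker (LinearMap.snd (ZMod 2) (Fin (k + 1) → ZMod 2) (Fin (k + 1) → ZMod 2))) ≤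
          (finrank (ZMod 2) ↥base.evenVirtualKernel + 1) / 2 ∧
      finrank (ZMod 2) ↥(base.evenPencil (fun _ => 0) ⊓
        LinearMap.ker (LinearMap.fst (ZMod 2) (Fin (k + 1) → ZMod 2) (Fin (k + 1) → ZMod 2))) ≤
          (finrank (ZMod 2) ↥base.evenVirtualKernel + 1) / 2 ∧
      finrank (ZMod 2) ↥(base.evenPencil (fun _ => 0) ⊓ LinearMap.ker (LinearMap.fst (ZMod 2) (Fin (k + 1) → ZMod 2) (Fin (k + 1) → ZMod 2) +
        LinearMap.snd (ZMod 2) (Fin (k + 1) → ZMod 2) (Fin (k + 1) → ZMod 2))) ≤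
          (finrank (ZMod 2) ↥base.evenVirtualKernel + 1) / 2 := by
  have h2 : ∀ x : ZMod 2, x + x = 0 := by decide
  have hd1 : ∀ b, bz (negTwo (base.cls b)) = 1 := fun b => by rw [hd b]; rfl
  obtain ⟨b₅, hb₅⟩ := h5
  have hm5 : bz (negNegOne (base.cls b₅)) = 0 := by rw [hb₅]; rfl
  -- `τ ≥ 1` from the kernel parity
  obtain ⟨r, hr⟩ := odd_finrank_evenVirtualKernel base hμ
  have hτ1 : 1 ≤ (finrank (ZMod 2) ↥base.evenVirtualKernel + 1) / 2 := by omega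
  set δ : Fin (k + 1) → ZMod 2 := fun _ => 0 with hδdef
  -- elements of the pencil of `δ = 0`
  have hpen : ∀ p : (Fin (k + 1) → ZMod 2) × (Fin (k + 1) → ZMod 2), p ∈ base.evenPencil δ →
      ∃ (u v : Fin (k + 1) → ZMod 2) (γ : ZMod 2),
        ((∀ i, (∑ j, bz (base.neg i j) * (u j + u i)) + bz (negNegOne (base.cls i)) * (∑ j, bz (negNegOne (base.cls j)) * u j) +
            u i + bz (negNegOne (base.cls i)) * v i = 0) ∧
         (∀ i, u i + (∑ j, bz (base.neg i j) * (v j + v i)) + bz (negNegOne (base.cls i)) * v i + v i +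
            bz (negNegOne (base.cls i)) * (∑ j, bz (negNegOne (base.cls j)) * u j) = 0)) ∧
        p = (fun b => v b + ∑ j, bz (negNegOne (base.cls j)) * u j, fun b => u b + γ) := by
    intro p hp
    obtain ⟨u, v, γ, hE1, hE2, rfl⟩ := (mem_evenPencil_iff base δ p).1 hp
    simp only [hd1, one_mul] at hE1 hE2
    refine ⟨u, v, γ, ⟨hE1, hE2⟩, ?_⟩
    refine Prod.ext ?_ ?_
    · funext b; simp [hδdef]
    · funext b; simp [hδdef]
  -- legitimacy: `(0, 1) ∉ T_0(𝒦_ev)` since `(1, 1) ∉ 𝒦_ev`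
  have hleg : ((δ, fun i => 1 + δ i) : (Fin (k + 1) → ZMod 2) × (Fin (k + 1) → ZMod 2)) ∉
      base.evenVirtualKernel.map (base.evenTwist δ) := by
    intro h
    obtain ⟨q, hq, hTq⟩ := Submodule.mem_map.1 h
    rw [evenTwist_apply] at hTq
    have hq1 : q.1 = fun _ => 1 := by
      funext i; have := congrFun (congrArg Prod.snd hTq) i; simpa [hδdef] using this
    have hE1 := ((mem_evenVirtualKernel_iff base q).1 hq).1 b₅
    rw [hq1] at hE1
    simp only [hd1, hm5, h2, mul_zero, Finset.sum_const_zero, zero_add, zero_mul, add_zero, one_mul] at hE1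
    exact one_ne_zero hE1
  -- (h1) the `V × 0` section: `(v, 0)` with `(0, v) ∈ 𝒦_ev`
  have hP1 : base.evenPencil δ ⊓ LinearMap.ker (LinearMap.snd (ZMod 2) (Fin (k + 1) → ZMod 2) (Fin (k + 1) → ZMod 2)) ≤
      (base.evenVirtualKernel ⊓ LinearMap.ker (LinearMap.fst (ZMod 2) (Fin (k + 1) → ZMod 2) (Fin (k + 1) → ZMod 2))).map
        ((LinearMap.snd (ZMod 2) (Fin (k + 1) → ZMod 2) (Fin (k + 1) → ZMod 2)).prod
          (LinearMap.fst (ZMod 2) (Fin (k + 1) → ZMod 2) (Fin (k + 1) → ZMod 2))) := by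
    intro p hp
    obtain ⟨hpW, hp0⟩ := Submodule.mem_inf.1 hp
    obtain ⟨u, v, γ, ⟨hE1, hE2⟩, rfl⟩ := hpen p hpW
    rw [LinearMap.mem_ker, LinearMap.snd_apply] at hp0
    have hu : ∀ b, u b = γ := fun b => by
      have := congrFun hp0 b; simp only [Pi.zero_apply] at this
      linear_combination this - h2 γ
    have hMu : (∑ j, bz (negNegOne (base.cls j)) * u j) = γ := by
      simp only [hu]; rw [← Finset.sum_mul, hμ, one_mul]
    -- at the prime `≡ 5 (mod 8)`: `γ = 0`
    have hγ : γ = 0 := by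
      have e := hE1 b₅
      simp only [hu, hm5, h2, mul_zero, Finset.sum_const_zero, zero_add, zero_mul, add_zero] at e
      exact e
    have hu0 : ∀ b, u b = 0 := fun b => by rw [hu b, hγ]
    have hq : ((0 : Fin (k + 1) → ZMod 2), v) ∈ base.evenVirtualKernel := by
      rw [mem_evenVirtualKernel_iff]
      simp only [hd1, one_mul]
      refine ⟨fun i => ?_, fun i => ?_⟩
      · have e := hE1 i
        simp only [hu0, h2, mul_zero, Finset.sum_const_zero, zero_add] at e
        simpa using e
      · have e := hE2 i
        simp only [hu0, mul_zero, Finset.sum_const_zero, zero_add, add_zero] at e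
        simpa using e
    refine Submodule.mem_map.2 ⟨((0 : Fin (k + 1) → ZMod 2), v), Submodule.mem_inf.2 ⟨hq, by simp⟩, ?_⟩
    refine Prod.ext ?_ ?_
    · funext b; simp [hMu, hγ]
    · funext b; simp [hu0 b, hγ]
  -- (h2) the `0 × V` section is the line `⟨(0, 1)⟩`
  have hP2 : base.evenPencil δ ⊓ LinearMap.ker (LinearMap.fst (ZMod 2) (Fin (k + 1) → ZMod 2) (Fin (k + 1) → ZMod 2)) ≤
      Submodule.span (ZMod 2) {((0 : Fin (k + 1) → ZMod 2), fun _ => (1 : ZMod 2))} := by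
    intro p hp
    obtain ⟨hpW, hp0⟩ := Submodule.mem_inf.1 hp
    obtain ⟨u, v, γ, ⟨hE1, hE2⟩, rfl⟩ := hpen p hpW
    rw [LinearMap.mem_ker, LinearMap.fst_apply] at hp0
    set ε : ZMod 2 := ∑ j, bz (negNegOne (base.cls j)) * u j with hε
    have hv : ∀ b, v b = ε := fun b => by
      have := congrFun hp0 b; simp only [Pi.zero_apply] at this
      linear_combination this - h2 ε
    have hu : ∀ b, u b = ε := fun b => by
      have e := hE2 b
      simp only [hv, h2, mul_zero, Finset.sum_const_zero] at e
      linear_combination e - h2 (bz (negNegOne (base.cls b)) * ε) - h2 ε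
    have hε0 : ε = 0 := by
      have e := hE1 b₅
      simp only [hu, hv, h2, mul_zero, Finset.sum_const_zero, zero_add, hm5, zero_mul, add_zero] at e
      exact e
    rw [Submodule.mem_span_singleton]
    refine ⟨γ, Prod.ext ?_ ?_⟩
    · funext b; simp [hv b, hε0]
    · funext b; simp [hu b, hε0]
  -- (h3) the diagonal section is `0`
  have hP3 : base.evenPencil δ ⊓ LinearMap.ker (LinearMap.fst (ZMod 2) (Fin (k + 1) → ZMod 2) (Fin (k + 1) → ZMod 2) +
      LinearMap.snd (ZMod 2) (Fin (k + 1) → ZMod 2) (Fin (k + 1) → ZMod 2)) ≤ ⊥ := by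
    intro p hp
    obtain ⟨hpW, hp0⟩ := Submodule.mem_inf.1 hp
    obtain ⟨u, v, γ, ⟨hE1, hE2⟩, rfl⟩ := hpen p hpW
    rw [LinearMap.mem_ker, LinearMap.add_apply, LinearMap.fst_apply, LinearMap.snd_apply] at hp0
    set ε : ZMod 2 := ∑ j, bz (negNegOne (base.cls j)) * u j with hε
    have hv : ∀ b, v b = u b + ε + γ := fun b => by
      have := congrFun hp0 b; simp only [Pi.add_apply, Pi.zero_apply] at this
      linear_combination this - h2 (u b) - h2 ε - h2 γ
    have hκ : ∀ b, u b = ε + γ := fun b => by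
      have e1 := hE1 b
      have e2 := hE2 b
      have hS : (∑ j, bz (base.neg b j) * (v j + v b)) = ∑ j, bz (base.neg b j) * (u j + u b) :=
        Finset.sum_congr rfl fun j _ => by rw [hv j, hv b]; linear_combination (bz (base.neg b j)) * (h2 ε + h2 γ)
      rw [hS, hv b] at e2
      rw [hv b] at e1
      linear_combination e1 - e2 + h2 (u b)
    have hM' : (∑ j, bz (negNegOne (base.cls j)) * u j) = ε + γ := by
      rw [Finset.sum_congr rfl (fun j _ => by rw [hκ j]), ← Finset.sum_mul, hμ, one_mul]
    have hεκ : ε = ε + γ := hε.trans hM'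
    have hγ : γ = 0 := by linear_combination -hεκ
    have hε0 : ε = 0 := by
      have e := hE1 b₅
      rw [hv b₅] at e
      simp only [hκ, hγ, add_zero, h2, mul_zero, Finset.sum_const_zero, zero_add, hm5, zero_mul] at e
      exact e
    rw [Submodule.mem_bot]
    refine Prod.ext ?_ ?_
    · funext b; simp [hv b, hκ b, hγ, hε0]
    · funext b; simp [hκ b, hγ, hε0]
  -- assemble
  have b1 := (Submodule.finrank_mono hP1).trans ((Submodule.finrank_map_le _ _).trans ha1)
  have b2 : finrank (ZMod 2) ↥(base.evenPencil δ ⊓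
      LinearMap.ker (LinearMap.fst (ZMod 2) (Fin (k + 1) → ZMod 2) (Fin (k + 1) → ZMod 2))) ≤
        (finrank (ZMod 2) ↥base.evenVirtualKernel + 1) / 2 := by
    refine (Submodule.finrank_mono hP2).trans ?_
    refine (finrank_span_le_card _).trans ?_
    simp only [Set.toFinset_singleton, Finset.card_singleton]
    exact hτ1
  have b3 : finrank (ZMod 2) ↥(base.evenPencil δ ⊓ LinearMap.ker (LinearMap.fst (ZMod 2) (Fin (k + 1) → ZMod 2) (Fin (k + 1) → ZMod 2) +
      LinearMap.snd (ZMod 2) (Fin (k + 1) → ZMod 2) (Fin (k + 1) → ZMod 2))) ≤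
        (finrank (ZMod 2) ↥base.evenVirtualKernel + 1) / 2 := by
    refine (Submodule.finrank_mono hP3).trans ?_
    rw [finrank_bot]; exact Nat.zero_le _
  have hdim : finrank (ZMod 2) ↥(base.evenPencil δ) = 2 * ((finrank (ZMod 2) ↥base.evenVirtualKernel + 1) / 2) := by
    rw [finrank_evenPencil_eq base δ hleg, hr]; omega
  exact ⟨hleg, hdim, b1, b2, b3⟩

/-- ★★★ **EVEN DESIGN ON THE FAMILY `P_b ≡ 3, 5 (mod 8)`.** Under the hypotheses of `evenPencil_zero_hypotheses_of_negTwo_true` (all `(2/P_b) = −1`,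
μ odd, some `P_b ≡ 5 (mod 8)`, and the vertical pairs of dimension `≤ τ₀^{ev}`) the design `δ = 0` yields a pattern-free Heegner recipe with
`τ₀^{ev} + 1` auxiliary primes. [cite: HeathBrown1994SelmerCongruentII, Appendix (Monsky), typescript p. 41 L20–L36] -/
theorem exists_patternFree_even_design_of_negTwo_true (hd : ∀ b, negTwo (base.cls b) = true)
    (hμ : (∑ b, bz (negNegOne (base.cls b))) = 1) (h5 : ∃ b, negNegOne (base.cls b) = false)
    (ha1 : finrank (ZMod 2) ↥(base.evenVirtualKernel ⊓
      LinearMap.ker (LinearMap.fst (ZMod 2) (Fin (k + 1) → ZMod 2) (Fin (k + 1) → ZMod 2))) ≤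
        (finrank (ZMod 2) ↥base.evenVirtualKernel + 1) / 2) :
    ∃ (c₁ : AuxCell) (rest : List AuxCell), rest.length = (finrank (ZMod 2) ↥base.evenVirtualKernel + 1) / 2 ∧
      heegnerK base (c₁ :: rest) = true ∧ ∀ pat : ℕ → ℕ → Bool, (dataK base (c₁ :: rest) pat).monskyEvenS.det = 1 := by
  obtain ⟨hδ, hdim, h1, h2, h3⟩ := evenPencil_zero_hypotheses_of_negTwo_true base hd hμ h5 ha1
  exact exists_patternFree_even_design_pencil base _ _ hδ hdim h1 h2 h3

/-- ★★★ **The even one-stage door on the family `P_b ≡ 3, 5 (mod 8)` is OPEN IFF the vertical pairs fit.** For such a base (μ odd, some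
`P_b ≡ 5 (mod 8)`): SOME `(δ, τ)` satisfies the five hypotheses of EVEN THEOREM A `exists_patternFree_even_design_pencil` if and only if
`dim{(0,v) ∈ 𝒦_ev} ≤ τ₀^{ev} = (dim 𝒦_ev + 1)/2` — and then `δ = 0`, `τ = τ₀^{ev}` works. (`→` is the obstruction `finrank_le_evenPencil_inf_ker_snd`
of p750799 plus the kernel parity; the first even exceptional bases `(3,5,5,5,5)` of `even_universality_fails` lie in this family.)
[cite: HeathBrown1994SelmerCongruentII, Appendix (Monsky), typescript p. 41 L20–L36] -/
theorem even_door_iff_of_negTwo_true (hd : ∀ b, negTwo (base.cls b) = true)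
    (hμ : (∑ b, bz (negNegOne (base.cls b))) = 1) (h5 : ∃ b, negNegOne (base.cls b) = false) :
    (∃ (δ : Fin (k + 1) → ZMod 2) (τ : ℕ),
      ((δ, fun i => 1 + δ i) : (Fin (k + 1) → ZMod 2) × (Fin (k + 1) → ZMod 2)) ∉ base.evenVirtualKernel.map (base.evenTwist δ) ∧
      finrank (ZMod 2) ↥(base.evenPencil δ) = 2 * τ ∧
      finrank (ZMod 2) ↥(base.evenPencil δ ⊓
        LinearMap.ker (LinearMap.snd (ZMod 2) (Fin (k + 1) → ZMod 2) (Fin (k + 1) → ZMod 2))) ≤ τ ∧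
      finrank (ZMod 2) ↥(base.evenPencil δ ⊓
        LinearMap.ker (LinearMap.fst (ZMod 2) (Fin (k + 1) → ZMod 2) (Fin (k + 1) → ZMod 2))) ≤ τ ∧
      finrank (ZMod 2) ↥(base.evenPencil δ ⊓ LinearMap.ker (LinearMap.fst (ZMod 2) (Fin (k + 1) → ZMod 2) (Fin (k + 1) → ZMod 2) +
        LinearMap.snd (ZMod 2) (Fin (k + 1) → ZMod 2) (Fin (k + 1) → ZMod 2))) ≤ τ) ↔
    finrank (ZMod 2) ↥(base.evenVirtualKernel ⊓
      LinearMap.ker (LinearMap.fst (ZMod 2) (Fin (k + 1) → ZMod 2) (Fin (k + 1) → ZMod 2))) ≤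
        (finrank (ZMod 2) ↥base.evenVirtualKernel + 1) / 2 := by
  constructor
  · rintro ⟨δ, τ, hδ, hdim, h1, -, -⟩
    have hτ : τ = (finrank (ZMod 2) ↥base.evenVirtualKernel + 1) / 2 := by
      have e := finrank_evenPencil_eq base δ hδ
      rw [hdim] at e
      omega
    rw [← hτ]
    refine (finrank_le_evenPencil_inf_ker_snd base δ _ inf_le_left fun p hp => ?_).trans h1
    exact (Submodule.mem_inf.1 hp).2
  · intro ha1
    obtain ⟨hδ, hdim, h1, h2, h3⟩ := evenPencil_zero_hypotheses_of_negTwo_true base hd hμ h5 ha1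
    exact ⟨fun _ => 0, _, hδ, hdim, h1, h2, h3⟩

end ClassesThreeFive

end Summit.BirchSwinnertonDyer.BirchSwinnertonDyer.Theorems.SymbolicMonsky
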